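import Literature.MeasureTheory.Group.ConjClassClosedEmbedding      -- ★ `isCompact_preimage_descConj_id_of_isClosed`, `descConj_eq_comp`, `continuous_descConj_id`
import HarnessLib

/-!
# The ORBIT MEASURE of a closed conjugacy class: the push-forward of a measure on `G ⧸ C(γ)` along the orbit map `y C(γ) ↦ y γ y⁻¹` is a Radon measure
# ON `G`, and orbital integrals are plain integrals against it (Deitmar–Echterhoff Lemma 9.3.3; Rogawski 1990 §4.9)

Topic `MeasureTheory/Group`; namespace `Literature.MeasureTheory.Group`.  THEOREMS ONLY (no `def`, no instance, no notation, no axiom, no `sorry`).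
Cell `pub/hodgecm-mathlib`, ENGINE T1 (crux H413 = `stmt-HodgeConjecture-24833`); floor-2 road «(J-nc) in-house», brick (R1-f) of R1 `stub_LuseAllPlaces` (LEAD F0P3a-plan (g9)
WORDS T8-53 ∕ T8-57 ∕ T8-61; census `CENSUS-R1-LuseAllPlaces` 8d436054; author F0P3a-p07 (g7), 2026-09-01).  Generic (any σ-compact locally compact Hausdorff group).

WHY (R1's orbit-measure currency).  R1 moves the split-singular point to the wall one place at a time; after a NONCOMPACT-wall step at the place `w` the `w`-factor of the state is a
singular orbital integral `∫ descConj γ Z _ u d(quotientMeasure …)` over `G_w ⧸ Z`.  To hand the state to the next place in the uniform shape «`∫ u dμ_w` with `μ_w` a Radon measure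
ON `G_w`» (the input of ★ (R1-a) p841031 ∕ ★ (R1-b′) p841084), the quotient integral is read as an integral against the ORBIT MEASURE `μ^{orb} := qm.map (y Z ↦ y γ y⁻¹)`:
* `integral_descConj_eq_integral_map_descConj_id` — `∫ descConj γ M _ u dqm = ∫ u d(qm.map (descConj γ M _ id))` for `u` a.e.-strongly measurable (★ `descConj_eq_comp` + `integral_map`);
  `integral_descConj_eq_integral_map_descConj_id_of_continuous` (continuous `u`).
* `isFiniteMeasureOnCompacts_map_descConj_id` — for a CLOSED class and `M = C(γ)`, the orbit measure of a measure finite on compacts is finite on compacts (the orbit map is proper: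
  ★ `isCompact_preimage_descConj_id_of_isClosed`); `sigmaFinite_map_descConj_id` (σ-compact `G`).
Precedent in the tree: the `GL_n` Levi descent ★ `GLnLeviOrbitalDescentBochner` already speaks of `μ.map (descConj p T _ id)`; this file is the generic statement.
HONEST LABEL: HC_CM is proved only modulo the 7 printed citations until rung 0 closes; this file is measure-theoretic bookkeeping and pays nothing by itself.

## References
* [DeitmarEchterhoff2014] A. Deitmar, S. Echterhoff, *Principles of Harmonic Analysis*, 2nd ed. (2014), Lemma 9.3.3 (closed orbits, proper orbit maps), Thm. 1.5.3.
* [Rogawski1990] J. D. Rogawski, *Automorphic Representations of Unitary Groups in Three Variables*, Ann. of Math. Stud. 123 (1990), §4.9 p. 54 (orbital integrals), §8.2 p. 123.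
-/

set_option autoImplicit false

noncomputable section

open MeasureTheory Measure Topology Set

namespace Literature.MeasureTheory.Group

section OrbitMeasure

variable {G : Type*} [Group G] [TopologicalSpace G] [IsTopologicalGroup G] (γ₀ : G) (M : Subgroup G) (hM : ∀ h ∈ M, h * γ₀ = γ₀ * h)
  [MeasurableSpace G] [BorelSpace G] [MeasurableSpace (G ⧸ M)] [BorelSpace (G ⧸ M)]

/-- **Orbital integrals are integrals against the ORBIT MEASURE**: `∫ (descConj γ₀ M u)(y) dqm(y) = ∫ u d(qm.map (y M ↦ y γ₀ y⁻¹))` for `u` a.e.-strongly measurable w.r.t. the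
orbit measure (★ `descConj_eq_comp`: the orbital integrand is `u ∘` the orbit map; Mathlib `integral_map`). [cite: DeitmarEchterhoff2014, Lemma 9.3.3] [cite: Rogawski1990, §4.9 p. 54] -/
theorem integral_descConj_eq_integral_map_descConj_id {E : Type*} [NormedAddCommGroup E] [NormedSpace ℝ E] (qm : Measure (G ⧸ M))
    (u : G → E) (hu : AEStronglyMeasurable u (qm.map (descConj γ₀ M hM id))) :
    ∫ y, descConj γ₀ M hM u y ∂qm = ∫ x, u x ∂(qm.map (descConj γ₀ M hM id)) := by
  rw [integral_map (continuous_descConj_id γ₀ M hM).measurable.aemeasurable hu, descConj_eq_comp γ₀ M hM u]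
  rfl

/-- Continuous-integrand form of `integral_descConj_eq_integral_map_descConj_id`. [cite: DeitmarEchterhoff2014, Lemma 9.3.3] -/
theorem integral_descConj_eq_integral_map_descConj_id_of_continuous [SecondCountableTopology G] {E : Type*} [NormedAddCommGroup E] [NormedSpace ℝ E]
    (qm : Measure (G ⧸ M)) (u : G → E) (hu : Continuous u) :
    ∫ y, descConj γ₀ M hM u y ∂qm = ∫ x, u x ∂(qm.map (descConj γ₀ M hM id)) :=
  integral_descConj_eq_integral_map_descConj_id γ₀ M hM qm u hu.aestronglyMeasurable

/-- **THE ORBIT MEASURE OF A CLOSED CLASS IS FINITE ON COMPACTS**: for `M = C(γ₀)` and a CLOSED conjugacy class, the orbit map `G ⧸ M → G` is proper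
(★ `isCompact_preimage_descConj_id_of_isClosed`), so the push-forward of a measure finite on compacts is finite on compacts. [cite: DeitmarEchterhoff2014, Lemma 9.3.3] -/
theorem isFiniteMeasureOnCompacts_map_descConj_id [SigmaCompactSpace G] [LocallyCompactSpace G] [T2Space G]
    (hO : IsClosed {g | ∃ y : G, y * γ₀ * y⁻¹ = g}) (hMeq : M = Subgroup.centralizer ({γ₀} : Set G))
    (qm : Measure (G ⧸ M)) [IsFiniteMeasureOnCompacts qm] :
    IsFiniteMeasureOnCompacts (qm.map (descConj γ₀ M hM id)) := by
  subst hMeq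
  refine ⟨fun K hK => ?_⟩
  rw [Measure.map_apply (continuous_descConj_id γ₀ _ hM).measurable hK.measurableSet]
  exact (isCompact_preimage_descConj_id_of_isClosed γ₀ hO hK).measure_lt_top

/-- … and σ-finite (σ-compact `G`). [cite: DeitmarEchterhoff2014, Lemma 9.3.3] -/
theorem sigmaFinite_map_descConj_id [SigmaCompactSpace G] [LocallyCompactSpace G] [T2Space G]
    (hO : IsClosed {g | ∃ y : G, y * γ₀ * y⁻¹ = g}) (hMeq : M = Subgroup.centralizer ({γ₀} : Set G))
    (qm : Measure (G ⧸ M)) [IsFiniteMeasureOnCompacts qm] :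
    SigmaFinite (qm.map (descConj γ₀ M hM id)) := by
  haveI := isFiniteMeasureOnCompacts_map_descConj_id γ₀ M hM hO hMeq qm
  infer_instance

/-- **Transport along a topological-group isomorphism**: the orbit measure read on an isomorphic copy `G′` of `G` (`e : G ≃ₜ* G′`) — `∫ descConj γ₀ M _ (u ∘ e) dqm = ∫ u d((qm.map
(descConj γ₀ M _ id)).map e)` — the shape in which a RELABELLED singular term (J1's `e_τ : G_w(α∘τ) ≃ₜ* G_w(α)`) becomes an integral against a Radon measure on the target group.
[cite: DeitmarEchterhoff2014, Lemma 9.3.3] [cite: Rogawski1990, §8.2 p. 123] -/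
theorem integral_descConj_comp_equiv_eq_integral_map_map [SecondCountableTopology G] {G' : Type*} [Group G'] [TopologicalSpace G'] [MeasurableSpace G']
    [BorelSpace G'] [SecondCountableTopology G'] {E : Type*} [NormedAddCommGroup E] [NormedSpace ℝ E]
    (qm : Measure (G ⧸ M)) (e : G ≃ₜ* G') (u : G' → E) (hu : Continuous u) :
    ∫ y, descConj γ₀ M hM (fun k => u (e k)) y ∂qm = ∫ x, u x ∂((qm.map (descConj γ₀ M hM id)).map e) := by
  have he : AEMeasurable (fun x : G => e x) (qm.map (descConj γ₀ M hM id)) := e.continuous.measurable.aemeasurable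
  rw [integral_map he hu.aestronglyMeasurable]
  exact integral_descConj_eq_integral_map_descConj_id_of_continuous γ₀ M hM qm _ (hu.comp e.continuous)

/-- The transported orbit measure is finite on compacts (closed class, `M = C(γ₀)`). [cite: DeitmarEchterhoff2014, Lemma 9.3.3] -/
theorem isFiniteMeasureOnCompacts_map_map_descConj_id {G' : Type*} [Group G'] [TopologicalSpace G'] [MeasurableSpace G'] [BorelSpace G']
    [T2Space G'] [SigmaCompactSpace G] [LocallyCompactSpace G] [T2Space G]
    (hO : IsClosed {g | ∃ y : G, y * γ₀ * y⁻¹ = g}) (hMeq : M = Subgroup.centralizer ({γ₀} : Set G))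
    (qm : Measure (G ⧸ M)) [IsFiniteMeasureOnCompacts qm] (e : G ≃ₜ* G') :
    IsFiniteMeasureOnCompacts ((qm.map (descConj γ₀ M hM id)).map e) := by
  haveI := isFiniteMeasureOnCompacts_map_descConj_id γ₀ M hM hO hMeq qm
  refine ⟨fun K hK => ?_⟩
  have he : Measurable (fun x : G => e x) := e.continuous.measurable
  rw [Measure.map_apply he hK.measurableSet]
  exact (e.toHomeomorph.isCompact_preimage.mpr hK).measure_lt_top

end OrbitMeasure

end Literature.MeasureTheory.Group

end
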